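import Summits.CriticalPhenomena.PercolationContinuityZ3.Theorems.PercNearOneGluingNoHeavyLowerTailFKCSHPhiMonotoneTools
import HarnessLib

/-!
# FK sub-lane: the almost-sure cluster of `Y`, the base-case form of `Θ_w`, and the ISLAND identity

Support file (`--supports stmt-CriticalPhenomena-4575`), FK sub-lane `prim-bschramm-fk-1` (gen 3); builds on p205010 (kernel theorem,
internal audit signed; external expert review pending).  No definitions, no named facts, no sorries; standard axioms.

* `FK.reachY_iff_of_support`: if every pair meeting the weight-1 cluster `A = C_Y(oneSet v)` has parameter `0` or `1`, then `C_Y(ω) = A`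
  for every `ω` in the support of `φ_v`;
* `FK.Th_base`: then `Θ_w(v) = 1{x ∉ A}·(a_w(A) − E_v g(C_x))`;  `FK.Th_eq_zero_of_reach`: if `x ∈ A` then `Θ_w(v') = 0` for all `v' ≥ v`;
* `FK.rcE_island`: then, if `x ∉ A`, `E_v g(C_x) = E_{v−Ā} g(C_x)` — van den Berg–Häggström–Kahn's Lemma 2.3 for `φ_{𝐩,q}` summed over the
  classes `{C_Y = W}` (tree `BHK2006.rcMass_sum_setCl_eq`): the parameters inside the a.s. cluster are invisible outside it.
[cite: VandenbergHaggstromKahn2005, §2.1 Lemma 2.3 (p. 10)] [cite: Grimmett2006, Thm. (3.7) (p. 39); §1.4 eq. (1.20) (p. 15)]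
-/

noncomputable section

namespace Summit.CriticalPhenomena.PercolationContinuityZ3.Theorems

open MeasureTheory Set Literature.Probability.LatticeModels Literature.Probability.Percolation
open scoped Classical
open BHK2006 DecisionTree HullPort

namespace FK

variable {V : Type*} [Fintype V]

omit [Fintype V] in
/-- `cut Y ω` depends on `ω` only through the set of vertices joined to `Y`. [folklore] -/
theorem cut_congr (Y : Set V) {ω ω' : BondConfig V}
    (h : ∀ z, (∃ y ∈ Y, (openGraph ω).Reachable y z) ↔ (∃ y ∈ Y, (openGraph ω').Reachable y z)) :
    cut Y ω = cut Y ω' := by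
  ext e
  simp only [cut, mem_setOf_eq]
  exact exists_congr fun v => and_congr_right fun _ => h v

omit [Fintype V] in
/-- `{x ↮ Y}` depends on `ω` only through the set of vertices joined to `Y`. [folklore] -/
theorem mem_avoidEv_congr (x : V) (Y : Set V) {ω ω' : BondConfig V}
    (h : ∀ z, (∃ y ∈ Y, (openGraph ω).Reachable y z) ↔ (∃ y ∈ Y, (openGraph ω').Reachable y z)) :
    ω ∈ avoidEv x Y ↔ ω' ∈ avoidEv x Y := by
  have e : ∀ η : BondConfig V, η ∈ avoidEv x Y ↔ ¬ ∃ y ∈ Y, (openGraph η).Reachable y x := fun η => by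
    simp only [avoidEv, mem_setOf_eq, not_exists, not_and]
    exact forall₂_congr fun y _ => ⟨fun h1 h2 => h1 h2.symm, fun h1 h2 => h1 h2.symm⟩
  rw [e, e, h x]

omit [Fintype V] in
/-- `x ∈ C_Y(ω)` iff `ω ∉ {x ↮ Y}`. [folklore] -/
theorem not_mem_avoidEv_iff (x : V) (Y : Set V) (ω : BondConfig V) :
    ω ∉ avoidEv x Y ↔ ∃ y ∈ Y, (openGraph ω).Reachable y x := by
  simp only [avoidEv, mem_setOf_eq, not_forall, not_not, exists_prop]
  exact exists_congr fun y => and_congr_right fun _ => ⟨fun h => h.symm, fun h => h.symm⟩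

/-- **The almost-sure cluster of `Y`.**  If every pair meeting the weight-1 cluster `A` of `Y` (the vertices joined to `Y` by pairs of
parameter `1`) has parameter `0` or `1`, then for every `ω` in the support of `φ_v` the vertices joined to `Y` in `ω` are exactly
those of `A`. [cite: Grimmett2006, §1.4 eq. (1.20) (p. 15)] -/
theorem reachY_iff_of_support (v : Sym2 V → unitInterval) (q : ℝ) (Y : Set V)
    (hA : ∀ f ∈ cut Y (oneSet v), v f = 0 ∨ v f = 1) {ω : BondConfig V} (hω : rcMass v q ω ≠ 0) (z : V) :
    (∃ y ∈ Y, (openGraph ω).Reachable y z) ↔ (∃ y ∈ Y, (openGraph (oneSet v)).Reachable y z) := by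
  obtain ⟨h1, h0⟩ := mem_of_rcMass_ne_zero v q hω
  have hsub : oneSet v ⊆ ω := fun f hf => h1 f hf
  constructor
  · rintro ⟨y, hy, hyz⟩
    -- walk along an open path from `y`; every step stays inside `A`
    rw [SimpleGraph.reachable_iff_reflTransGen] at hyz
    induction hyz with
    | refl => exact ⟨y, hy, SimpleGraph.Reachable.refl y⟩
    | @tail a b _ hab ih =>
      obtain ⟨y', hy', hy'a⟩ := ih
      rw [openGraph_adj] at hab
      have hcut : s(a, b) ∈ cut Y (oneSet v) := ⟨a, Sym2.mem_mk_left a b, y', hy', hy'a⟩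
      rcases hA _ hcut with h | h
      · exact absurd hab.1 (h0 _ h)
      · have hadj : (openGraph (oneSet v)).Adj a b := by
          rw [openGraph_adj]; exact ⟨h, hab.2⟩
        exact ⟨y', hy', hy'a.trans hadj.reachable⟩
  · rintro ⟨y, hy, hyz⟩
    exact ⟨y, hy, hyz.mono (openGraph_le hsub)⟩

/-- **Base-case form of `Θ_w`.**  If every pair meeting the weight-1 cluster `A` of `Y` is determined by `v`, then
`Θ_w(v) = 1{x ∉ A}·(a_w(A) − E_v g(C_x))`. [cite: VandenbergHaggstromKahn2005, §2.1 Lemma 2.3 (p. 10)] -/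
theorem Th_base (w : Sym2 V → unitInterval) {q : ℝ} (hq : 0 < q) (x : V) (Y : Set V) (g : Set (Sym2 V) → ℝ)
    (v : Sym2 V → unitInterval) (hA : ∀ f ∈ cut Y (oneSet v), v f = 0 ∨ v f = 1) :
    Th w q x Y g v = ind (avoidEv x Y) (oneSet v) * (rcE (delW w (cut Y (oneSet v))) q (Gx g x) - rcE v q (Gx g x)) := by
  unfold Th
  rw [← rcE_const_mul_sub v hq]
  refine rcE_congr_support v q fun ω hω => ?_
  have hR := reachY_iff_of_support v q Y hA hω
  unfold Xw
  rw [cut_congr Y hR]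
  congr 1
  by_cases h : ω ∈ avoidEv x Y
  · rw [ind_of_mem h, ind_of_mem ((mem_avoidEv_congr x Y hR).1 h)]
  · rw [ind_of_not_mem h, ind_of_not_mem (fun h' => h ((mem_avoidEv_congr x Y hR).2 h'))]

/-- If `x` lies in the weight-1 cluster of `Y` for `v`, then `Θ_w(v') = 0` for every `v' ≥ v` (under `φ_{v'}` the weight-1 pairs of
`v` are open a.s., so `x ↔ Y` a.s.). [cite: Grimmett2006, §1.4 eq. (1.20) (p. 15)] -/
theorem Th_eq_zero_of_reach (w : Sym2 V → unitInterval) (q : ℝ) (x : V) (Y : Set V) (g : Set (Sym2 V) → ℝ)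
    {v v' : Sym2 V → unitInterval} (hvv : ∀ e, v e ≤ v' e) (hx : oneSet v ∉ avoidEv x Y) : Th w q x Y g v' = 0 := by
  unfold Th
  have h0 : rcE v' q (fun _ => (0 : ℝ)) = 0 := by unfold rcE; simp
  rw [← h0]
  refine rcE_congr_support v' q fun ω hω => ?_
  have hsub : oneSet v ⊆ ω := fun f hf => (mem_of_rcMass_ne_zero v' q hω).1 f (oneSet_mono hvv hf)
  obtain ⟨y, hy, hyx⟩ := (not_mem_avoidEv_iff x Y (oneSet v)).1 hx
  have hω' : ω ∉ avoidEv x Y := (not_mem_avoidEv_iff x Y ω).2 ⟨y, hy, hyx.mono (openGraph_le hsub)⟩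
  unfold Xw
  rw [ind_of_not_mem hω', zero_mul]

/-- **ISLAND.**  If every pair meeting the weight-1 cluster `A` of `Y` is determined by `v` and `x ∉ A`, then
`E_v g(C_x) = E_{delW v Ā} g(C_x)`: conditionally on `C_Y = A` (an almost-sure event here) the configuration off `Ā` follows the
random-cluster measure with the pairs of `Ā` deleted (van den Berg–Häggström–Kahn's Lemma 2.3 for `φ_{𝐩,q}`), and `C_x` lives off `Ā`.
[cite: VandenbergHaggstromKahn2005, §2.1 Lemma 2.3 (p. 10)] -/
theorem rcE_island {q : ℝ} (hq : 0 < q) (x : V) (Y : Set V) (g : Set (Sym2 V) → ℝ) (v : Sym2 V → unitInterval)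
    (hA : ∀ f ∈ cut Y (oneSet v), v f = 0 ∨ v f = 1) (hx : oneSet v ∈ avoidEv x Y) :
    rcE v q (Gx g x) = rcE (delW v (cut Y (oneSet v))) q (Gx g x) := by
  set G : Set (Sym2 V) → ℝ := Gx g x with hG
  -- Lemma 2.3 class by class, summed over the classes `{setCl ω Y = W}`
  have hsum : ∑ W : Set (Sym2 V), ∑ ω, (if setCl ω Y = W then rcMass v q ω * G (ω \ barOf Y W) else 0) =
      ∑ W : Set (Sym2 V), (∑ ω, (if setCl ω Y = W then rcMass v q ω else 0)) *
        ∑ η, rcMass (delW v (barOf Y W)) q η * G η :=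
    Finset.sum_congr rfl fun W _ => rcMass_sum_setCl_eq v hq Y W G
  -- left side: `Σ_ω φ_v(ω) G(ω ∖ cut) = E_v G` on the support
  have hL : ∑ W : Set (Sym2 V), ∑ ω, (if setCl ω Y = W then rcMass v q ω * G (ω \ barOf Y W) else 0) = rcE v q G := by
    rw [Finset.sum_comm]
    unfold rcE
    refine Finset.sum_congr rfl fun ω _ => ?_
    rw [Fintype.sum_ite_eq (setCl ω Y) (fun W => rcMass v q ω * G (ω \ barOf Y W))]
    by_cases hω : rcMass v q ω = 0
    · rw [hω, zero_mul, zero_mul]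
    · have hR := reachY_iff_of_support v q Y hA hω
      have hav : ω ∈ avoidEv x Y := (mem_avoidEv_congr x Y hR).2 hx
      rw [← cut_eq_barOf, hG]
      simp only [Gx, CSH.openEdgeCluster_sdiff_cut_of_avoid hav]
  -- right side: every class of positive mass has `barOf Y W = cut Y (oneSet v)`
  have hR : ∑ W : Set (Sym2 V), (∑ ω, (if setCl ω Y = W then rcMass v q ω else 0)) *
      ∑ η, rcMass (delW v (barOf Y W)) q η * G η =
      ∑ W : Set (Sym2 V), (∑ ω, (if setCl ω Y = W then rcMass v q ω else 0)) *
        rcE (delW v (cut Y (oneSet v))) q G := by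
    refine Finset.sum_congr rfl fun W _ => ?_
    by_cases hm : ∑ ω, (if setCl ω Y = W then rcMass v q ω else 0) = 0
    · rw [hm, zero_mul, zero_mul]
    · obtain ⟨ω, -, hω⟩ := Finset.exists_ne_zero_of_sum_ne_zero hm
      have hcl : setCl ω Y = W := by by_contra h; exact hω (if_neg h)
      rw [if_pos hcl] at hω
      have hRω := reachY_iff_of_support v q Y hA hω
      rw [← hcl, ← cut_eq_barOf, cut_congr Y hRω]
      rfl
  have hmass : ∑ W : Set (Sym2 V), (∑ ω, (if setCl ω Y = W then rcMass v q ω else 0)) = 1 := by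
    rw [Finset.sum_comm]
    simp only [Fintype.sum_ite_eq]
    exact sum_rcMass v hq
  rw [hL, hR, ← Finset.sum_mul, hmass, one_mul] at hsum
  exact hsum

end FK

end Summit.CriticalPhenomena.PercolationContinuityZ3.Theorems

end
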